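import Literature.AlgebraicGeometry.AbelianSchemes.AbelianSchemeEndomorphismComplexDescent
import Literature.AlgebraicGeometry.AbelianSchemes.AbelianSchemeOverFibreConjugate
import Literature.AlgebraicGeometry.AbelianSchemes.FibreHomPointsOfFibrePoints
import HarnessLib

/-!
# The complex-points identity behind B-γ's fibre hypothesis, from the READINGS of the endomorphism at a point and at its Galois
# twist, once the canonical identification `(A_s)^σ ≅ A_{σs}` intertwines the two readings ([Milne 2005] §14 «σ(A, i, …) = (σA, σi, …)»)

Topic `AlgebraicGeometry/AbelianSchemes`; namespace `Literature.AlgebraicGeometry.AbelianSchemes.AbelianSchemeOver`.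
THEOREMS ONLY (no definition, no named fact, no instance, no `sorry`; net Literature debt 0).  Cell `hodgecm-mathlib` (D-0151), FLOOR 0, P6
door (E) of `stub_RGD`, E6 step 8 — **E6-γ brick (G2b-α)** (generic plumbing; the CM content enters only through the hypothesis `hΦ`, which
★ E6-γ-C `SiegelAdelicMarking.conjugate_comp_eq_comp_of_iso_of_lifts₂` supplies at special points).  `--supports stmt-HodgeConjecture-24832`,
count-neutral; HC_CM is proved only modulo the printed citations until rung 0 closes.

Binders = ★ B-γ's (`K`, `T : SchemeOver K`, `A : AbelianSchemeOver T.left`, by-value `galA` with clauses `hgal₁ hgal₂`); `rl` an endomorphism of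
the total space `A_ℂ = A ×_T T_ℂ` over `T_ℂ`; an honest complex point `x̃` of `T_ℂ` (`x̃ ≫ pr_ℂ = 𝟙`) with base point `s := x̃ ≫ pr_T`;
`σ ∈ Aut(ℂ/K)`.  The twisted honest point is `x̃′ := Spec σ ≫ x̃ ≫ gal σ` (★ `GaloisDescent.gal` = `1 × Spec σ⁻¹`), with base point `Spec σ ≫ s`,
and the canonical identification of fibres is ★ `conjFibreIso A σ s : (A_s)^σ ≅ A_{Spec σ ≫ s}` composed with ★ `conjPoints` — on points
`Φ(P) := conjFibreIso ((P)^σ)`, lying over `Spec σ ≫ P` (★ `map_conjFibreIso_conjPoints_left_fst`).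
**`forall_point_comp_galA_of_conjugate_reading`**: if `rl` READS as the self-map `ρ` of `A_s(ℂ)` at the complex points over `x̃` and as `ρ′` of
`A_{Spec σ ≫ s}(ℂ)` at the complex points over `x̃′` (relation form in the total space, first projections — the currency of A-p06's `ReadsC` (ii)), and
`Φ ∘ ρ = ρ′ ∘ Φ`, then `(q ≫ rl) ≫ pr_A = (q ≫ galA σ ≫ rl) ≫ pr_A` for every complex point `q` over `x̃` — the hypothesis of ★ (G2a)
`fibre_comp_galA_eq_of_forall_point'`; and **`forall_point_comp_galA_of_conjugate_comp_eq`** — the same with the readings given by fibre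
ENDOMORPHISMS `y, y′` and the intertwining as `y^σ ≫ conjFibreIso = conjFibreIso ≫ y′` (E6-γ-C's conclusion shape; ★ `conjPoints_map`).

## References
* [Milne2005ShimuraVarieties] J. S. Milne, *Introduction to Shimura varieties* (2005), §14 pp. 124–125, §13 Prop. 13.1 p. 117.
* [GortzWedhorn2020] U. Görtz, T. Wedhorn, *Algebraic Geometry I*, 2nd ed. (2020), §(4.7) (4.7.1), Prop. 4.16, §(14.20).
* [MumfordFogartyKirwan1994] D. Mumford, J. Fogarty, F. Kirwan, *Geometric Invariant Theory*, 3rd ed. (1994), Ch. 6 §1 Cor. 6.2 (p. 116).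
-/

set_option autoImplicit false

noncomputable section

open CategoryTheory CategoryTheory.Limits AlgebraicGeometry
open Literature.AlgebraicGeometry.Motives (SchemeOver AlgPoints AbelianVariety)
open Literature.AlgebraicGeometry.Motives.GaloisDescent (gal bc gal_fst gal_snd gal_fst_assoc gal_snd_assoc)
open Literature.AlgebraicGeometry.Motives.AbelianVariety (bcSpec specAut specAut_mul specAut_one)

namespace Literature.AlgebraicGeometry.AbelianSchemes

namespace AbelianSchemeOver

variable {K : Type} [Field K] [Algebra K ℂ] {T : SchemeOver K} (A : AbelianSchemeOver T.left)
  (galA : (ℂ ≃ₐ[K] ℂ) →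
    (pullback A.X.hom (pullback.fst T.hom (bcSpec K ℂ)) ⟶ pullback A.X.hom (pullback.fst T.hom (bcSpec K ℂ))))
  (hgal₁ : ∀ σ, galA σ ≫ pullback.fst A.X.hom (pullback.fst T.hom (bcSpec K ℂ)) =
    pullback.fst A.X.hom (pullback.fst T.hom (bcSpec K ℂ)))
  (hgal₂ : ∀ σ, galA σ ≫ pullback.snd A.X.hom (pullback.fst T.hom (bcSpec K ℂ)) =
    pullback.snd A.X.hom (pullback.fst T.hom (bcSpec K ℂ)) ≫ gal ℂ T σ)

/-- `Spec` of a `K`-algebra automorphism of `ℂ` read as a ring automorphism is ★ `specAut`. [folklore] -/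
private theorem specTwist_toRingEquiv (σ : ℂ ≃ₐ[K] ℂ) : specTwist σ.toRingEquiv = specAut ℂ σ := rfl

include hgal₁ hgal₂ in
/-- **The complex-points identity of ★ (G2a) `fibre_comp_galA_eq_of_forall_point'` from the two READINGS and the conjugation intertwining.**
Let `rl` be an endomorphism of `A_ℂ` over `T_ℂ`, `x̃` an honest complex point of `T_ℂ` with base point `s := x̃ ≫ pr_T`, `σ ∈ Aut(ℂ/K)`.  Suppose
`rl` reads as `ρ` on `A_s(ℂ)` at the complex points over `x̃` («`q ↦ P` ⟹ `q ≫ rl ↦ ρ P`», first projections) and as `ρ′` on `A_{Spec σ ≫ s}(ℂ)`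
at the complex points over the twisted honest point `Spec σ ≫ x̃ ≫ gal σ`, and that the canonical `Φ = conjFibreIso ∘ (·)^σ` intertwines:
`Φ(ρ P) = ρ′(Φ P)`.  Then `(q ≫ rl) ≫ pr_A = (q ≫ galA σ ≫ rl) ≫ pr_A` for every complex point `q` of `A_ℂ` over `x̃`.
(`q ≫ galA σ = Spec σ⁻¹ ≫ q′` with `q′` honest over the twisted point and `q′ ≫ pr_A = Spec σ ≫ q ≫ pr_A = pr_A(Φ P)` by
★ `map_conjFibreIso_conjPoints_left_fst`.) [cite: Milne2005ShimuraVarieties, §14 pp. 124–125] [cite: GortzWedhorn2020, Section (4.7), (4.7.1) and Prop. 4.16] -/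
theorem forall_point_comp_galA_of_conjugate_reading (σ : ℂ ≃ₐ[K] ℂ)
    (rl : pullback A.X.hom (pullback.fst T.hom (bcSpec K ℂ)) ⟶ pullback A.X.hom (pullback.fst T.hom (bcSpec K ℂ)))
    (x : Spec (.of ℂ) ⟶ bc ℂ T)
    (ρ : (A.fibre (x ≫ pullback.fst T.hom (bcSpec K ℂ))).toAbelianVariety.Points ℂ →
      (A.fibre (x ≫ pullback.fst T.hom (bcSpec K ℂ))).toAbelianVariety.Points ℂ)
    (ρ' : (A.fibre (specTwist σ.toRingEquiv ≫ x ≫ pullback.fst T.hom (bcSpec K ℂ))).toAbelianVariety.Points ℂ →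
      (A.fibre (specTwist σ.toRingEquiv ≫ x ≫ pullback.fst T.hom (bcSpec K ℂ))).toAbelianVariety.Points ℂ)
    (hread : ∀ (q : Spec (.of ℂ) ⟶ pullback A.X.hom (pullback.fst T.hom (bcSpec K ℂ)))
      (P : (A.fibre (x ≫ pullback.fst T.hom (bcSpec K ℂ))).toAbelianVariety.Points ℂ),
      q ≫ pullback.snd A.X.hom (pullback.fst T.hom (bcSpec K ℂ)) = x →
      q ≫ pullback.fst A.X.hom (pullback.fst T.hom (bcSpec K ℂ)) = A.fibrePointToLeft _ P →
        (q ≫ rl) ≫ pullback.fst A.X.hom (pullback.fst T.hom (bcSpec K ℂ)) = A.fibrePointToLeft _ (ρ P))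
    (hread' : ∀ (q' : Spec (.of ℂ) ⟶ pullback A.X.hom (pullback.fst T.hom (bcSpec K ℂ)))
      (P' : (A.fibre (specTwist σ.toRingEquiv ≫ x ≫ pullback.fst T.hom (bcSpec K ℂ))).toAbelianVariety.Points ℂ),
      q' ≫ pullback.snd A.X.hom (pullback.fst T.hom (bcSpec K ℂ)) = specAut ℂ σ ≫ x ≫ gal ℂ T σ →
      q' ≫ pullback.fst A.X.hom (pullback.fst T.hom (bcSpec K ℂ)) = A.fibrePointToLeft _ P' →
        (q' ≫ rl) ≫ pullback.fst A.X.hom (pullback.fst T.hom (bcSpec K ℂ)) = A.fibrePointToLeft _ (ρ' P'))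
    (hΦ : ∀ P : (A.fibre (x ≫ pullback.fst T.hom (bcSpec K ℂ))).toAbelianVariety.Points ℂ,
      AlgPoints.map (A.conjFibreIso σ.toRingEquiv (x ≫ pullback.fst T.hom (bcSpec K ℂ))).hom.hom.hom.hom
          ((A.fibre (x ≫ pullback.fst T.hom (bcSpec K ℂ))).toAbelianVariety.conjPoints σ.toRingEquiv (ρ P)) =
        ρ' (AlgPoints.map (A.conjFibreIso σ.toRingEquiv (x ≫ pullback.fst T.hom (bcSpec K ℂ))).hom.hom.hom.hom
          ((A.fibre (x ≫ pullback.fst T.hom (bcSpec K ℂ))).toAbelianVariety.conjPoints σ.toRingEquiv P)))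
    (q : Spec (.of ℂ) ⟶ pullback A.X.hom (pullback.fst T.hom (bcSpec K ℂ)))
    (hq : q ≫ pullback.snd A.X.hom (pullback.fst T.hom (bcSpec K ℂ)) = x) :
    (q ≫ rl) ≫ pullback.fst A.X.hom (pullback.fst T.hom (bcSpec K ℂ)) =
      (q ≫ galA σ ≫ rl) ≫ pullback.fst A.X.hom (pullback.fst T.hom (bcSpec K ℂ)) := by
  -- the point of `A` under `q`, and its partner `P ∈ A_s(ℂ)`
  have hz : (q ≫ pullback.fst A.X.hom (pullback.fst T.hom (bcSpec K ℂ))) ≫ A.X.hom = x ≫ pullback.fst T.hom (bcSpec K ℂ) := by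
    rw [Category.assoc, pullback.condition, reassoc_of% hq]
  obtain ⟨P, hP⟩ := A.exists_points_fibrePointToLeft_eq (x ≫ pullback.fst T.hom (bcSpec K ℂ)) (Over.homMk _ hz)
  change A.fibrePointToLeft _ P = q ≫ pullback.fst A.X.hom (pullback.fst T.hom (bcSpec K ℂ)) at hP
  -- the reading at `x̃`
  have h1 := hread q P hq hP.symm
  -- the twisted honest point `q′ := Spec σ ≫ q ≫ galA σ` and its partner `Φ P`
  have hq' : (specAut ℂ σ ≫ q ≫ galA σ) ≫ pullback.snd A.X.hom (pullback.fst T.hom (bcSpec K ℂ)) =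
      specAut ℂ σ ≫ x ≫ gal ℂ T σ := by
    rw [Category.assoc, Category.assoc, hgal₂, reassoc_of% hq]
  have hΦP : A.fibrePointToLeft _ (AlgPoints.map (A.conjFibreIso σ.toRingEquiv (x ≫ pullback.fst T.hom (bcSpec K ℂ))).hom.hom.hom.hom
        ((A.fibre (x ≫ pullback.fst T.hom (bcSpec K ℂ))).toAbelianVariety.conjPoints σ.toRingEquiv P)) =
      specAut ℂ σ ≫ q ≫ pullback.fst A.X.hom (pullback.fst T.hom (bcSpec K ℂ)) := by
    rw [← hP]
    exact A.map_conjFibreIso_conjPoints_left_fst σ.toRingEquiv (x ≫ pullback.fst T.hom (bcSpec K ℂ)) P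
  have hq'fst : (specAut ℂ σ ≫ q ≫ galA σ) ≫ pullback.fst A.X.hom (pullback.fst T.hom (bcSpec K ℂ)) =
      A.fibrePointToLeft _ (AlgPoints.map (A.conjFibreIso σ.toRingEquiv (x ≫ pullback.fst T.hom (bcSpec K ℂ))).hom.hom.hom.hom
        ((A.fibre (x ≫ pullback.fst T.hom (bcSpec K ℂ))).toAbelianVariety.conjPoints σ.toRingEquiv P)) := by
    rw [hΦP, Category.assoc, Category.assoc, hgal₁]
  -- the reading at the twisted point
  have h2 := hread' _ _ hq' hq'fst
  rw [← hΦ P] at h2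
  -- `Φ (ρ P)` lies over `Spec σ ≫ pr_A (ρ P)`
  have hΦρ := A.map_conjFibreIso_conjPoints_left_fst σ.toRingEquiv (x ≫ pullback.fst T.hom (bcSpec K ℂ)) (ρ P)
  -- assemble: cancel `Spec σ`
  have hinv : specAut ℂ σ⁻¹ ≫ specAut ℂ σ = 𝟙 _ := by rw [← specAut_mul, inv_mul_cancel, specAut_one]
  calc (q ≫ rl) ≫ pullback.fst A.X.hom (pullback.fst T.hom (bcSpec K ℂ))
      = A.fibrePointToLeft _ (ρ P) := h1
    _ = specAut ℂ σ⁻¹ ≫ (specTwist σ.toRingEquiv ≫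
          ((ρ P).left ≫ pullback.fst A.X.hom (x ≫ pullback.fst T.hom (bcSpec K ℂ)))) := by
        rw [specTwist_toRingEquiv, reassoc_of% hinv]
    _ = specAut ℂ σ⁻¹ ≫ ((specAut ℂ σ ≫ q ≫ galA σ) ≫ rl) ≫ pullback.fst A.X.hom (pullback.fst T.hom (bcSpec K ℂ)) := by
        rw [← hΦρ]
        exact congrArg (specAut ℂ σ⁻¹ ≫ ·) h2.symm
    _ = (q ≫ galA σ ≫ rl) ≫ pullback.fst A.X.hom (pullback.fst T.hom (bcSpec K ℂ)) := by
        simp only [Category.assoc, reassoc_of% hinv]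

include hgal₁ hgal₂ in
/-- **The same with the readings given by ENDOMORPHISMS of the two fibres and the intertwining in E6-γ-C's shape.**  If `rl` reads at the points
over `x̃` as the endomorphism `y` of `A_s` and at the points over the twisted point as the endomorphism `y′` of `A_{Spec σ ≫ s}`, and the canonical
`e₁ := conjFibreIso A σ s : (A_s)^σ ≅ A_{Spec σ ≫ s}` satisfies **`y^σ ≫ e₁ = e₁ ≫ y′`** (the conclusion of ★ E6-γ-C
`SiegelAdelicMarking.conjugate_comp_eq_comp_of_iso_of_lifts₂` at a special point), then `(q ≫ rl) ≫ pr_A = (q ≫ galA σ ≫ rl) ≫ pr_A` for every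
complex point `q` over `x̃` (naturality ★ `conjPoints_map` turns the intertwining into `Φ ∘ y = y′ ∘ Φ` on points).
[cite: Milne2005ShimuraVarieties, §14 pp. 124–125 and §11 p. 108] [cite: GortzWedhorn2020, Section (4.7), (4.7.1) and Prop. 4.16] -/
theorem forall_point_comp_galA_of_conjugate_comp_eq (σ : ℂ ≃ₐ[K] ℂ)
    (rl : pullback A.X.hom (pullback.fst T.hom (bcSpec K ℂ)) ⟶ pullback A.X.hom (pullback.fst T.hom (bcSpec K ℂ)))
    (x : Spec (.of ℂ) ⟶ bc ℂ T)
    (y : (A.fibre (x ≫ pullback.fst T.hom (bcSpec K ℂ))).toAbelianVariety ⟶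
      (A.fibre (x ≫ pullback.fst T.hom (bcSpec K ℂ))).toAbelianVariety)
    (y' : (A.fibre (specTwist σ.toRingEquiv ≫ x ≫ pullback.fst T.hom (bcSpec K ℂ))).toAbelianVariety ⟶
      (A.fibre (specTwist σ.toRingEquiv ≫ x ≫ pullback.fst T.hom (bcSpec K ℂ))).toAbelianVariety)
    (hread : ∀ (q : Spec (.of ℂ) ⟶ pullback A.X.hom (pullback.fst T.hom (bcSpec K ℂ)))
      (P : (A.fibre (x ≫ pullback.fst T.hom (bcSpec K ℂ))).toAbelianVariety.Points ℂ),
      q ≫ pullback.snd A.X.hom (pullback.fst T.hom (bcSpec K ℂ)) = x →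
      q ≫ pullback.fst A.X.hom (pullback.fst T.hom (bcSpec K ℂ)) = A.fibrePointToLeft _ P →
        (q ≫ rl) ≫ pullback.fst A.X.hom (pullback.fst T.hom (bcSpec K ℂ)) =
          A.fibrePointToLeft _ (AlgPoints.map y.hom.hom.hom P))
    (hread' : ∀ (q' : Spec (.of ℂ) ⟶ pullback A.X.hom (pullback.fst T.hom (bcSpec K ℂ)))
      (P' : (A.fibre (specTwist σ.toRingEquiv ≫ x ≫ pullback.fst T.hom (bcSpec K ℂ))).toAbelianVariety.Points ℂ),
      q' ≫ pullback.snd A.X.hom (pullback.fst T.hom (bcSpec K ℂ)) = specAut ℂ σ ≫ x ≫ gal ℂ T σ →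
      q' ≫ pullback.fst A.X.hom (pullback.fst T.hom (bcSpec K ℂ)) = A.fibrePointToLeft _ P' →
        (q' ≫ rl) ≫ pullback.fst A.X.hom (pullback.fst T.hom (bcSpec K ℂ)) =
          A.fibrePointToLeft _ (AlgPoints.map y'.hom.hom.hom P'))
    (hint : AbelianVariety.Hom.conjugate σ.toRingEquiv y ≫
        (A.conjFibreIso σ.toRingEquiv (x ≫ pullback.fst T.hom (bcSpec K ℂ))).hom =
      (A.conjFibreIso σ.toRingEquiv (x ≫ pullback.fst T.hom (bcSpec K ℂ))).hom ≫ y')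
    (q : Spec (.of ℂ) ⟶ pullback A.X.hom (pullback.fst T.hom (bcSpec K ℂ)))
    (hq : q ≫ pullback.snd A.X.hom (pullback.fst T.hom (bcSpec K ℂ)) = x) :
    (q ≫ rl) ≫ pullback.fst A.X.hom (pullback.fst T.hom (bcSpec K ℂ)) =
      (q ≫ galA σ ≫ rl) ≫ pullback.fst A.X.hom (pullback.fst T.hom (bcSpec K ℂ)) := by
  refine A.forall_point_comp_galA_of_conjugate_reading galA hgal₁ hgal₂ σ rl x
    (fun P => AlgPoints.map y.hom.hom.hom P) (fun P' => AlgPoints.map y'.hom.hom.hom P') hread hread' ?_ q hq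
  intro P
  rw [AbelianVariety.conjPoints_map]
  have hL : AlgPoints.map (A.conjFibreIso σ.toRingEquiv (x ≫ pullback.fst T.hom (bcSpec K ℂ))).hom.hom.hom.hom
        (AlgPoints.map (AbelianVariety.Hom.conjugate σ.toRingEquiv y).hom.hom.hom
          ((A.fibre (x ≫ pullback.fst T.hom (bcSpec K ℂ))).toAbelianVariety.conjPoints σ.toRingEquiv P)) =
      AlgPoints.map (AbelianVariety.Hom.conjugate σ.toRingEquiv y ≫
          (A.conjFibreIso σ.toRingEquiv (x ≫ pullback.fst T.hom (bcSpec K ℂ))).hom).hom.hom.hom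
        ((A.fibre (x ≫ pullback.fst T.hom (bcSpec K ℂ))).toAbelianVariety.conjPoints σ.toRingEquiv P) := by
    simp only [AlgPoints.map_apply]
    exact Category.assoc _ _ _
  have hR : AlgPoints.map y'.hom.hom.hom
        (AlgPoints.map (A.conjFibreIso σ.toRingEquiv (x ≫ pullback.fst T.hom (bcSpec K ℂ))).hom.hom.hom.hom
          ((A.fibre (x ≫ pullback.fst T.hom (bcSpec K ℂ))).toAbelianVariety.conjPoints σ.toRingEquiv P)) =
      AlgPoints.map ((A.conjFibreIso σ.toRingEquiv (x ≫ pullback.fst T.hom (bcSpec K ℂ))).hom ≫ y').hom.hom.hom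
        ((A.fibre (x ≫ pullback.fst T.hom (bcSpec K ℂ))).toAbelianVariety.conjPoints σ.toRingEquiv P) := by
    simp only [AlgPoints.map_apply]
    exact Category.assoc _ _ _
  rw [hL, hR, hint]

end AbelianSchemeOver

end Literature.AlgebraicGeometry.AbelianSchemes

end
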